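import Literature.IUT.HodgeTheaters.PuncturedEllipticCoveringsXbarCuspidalData
import Literature.IUT.HodgeTheaters.PuncturedEllipticCoveringsCor12GeomTFG
import Literature.AnabelianGeometry.AbsoluteAnabelian.AbsTopIChains
import HarnessLib

/-!
# [IUTchI] Cor. 1.2: the cuspidal input `hLem45` DERIVED from layer L4's typed [AbsTopI] Lem. 4.5 (v)
# (`CuspidalAlgorithm.RecoversCusps`) BY NAME — proofs only

S. Mochizuki, *Inter-universal Teichmüller theory I*, kurims manuscript (May 2020), §1, Corollary 1.2,
proof p. 39 ([IUTchI] Cor 1.2 p.39) [claim: Mochizuki2012, status: disputed]: "The conjugacy classes of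
the decomposition groups of `ε⁰`, `ε′`, `ε″` in `Π_X̲` may be recovered as the decomposition groups of
cusps [cf. [AbsTopI], Lemma 4.5, as well as Remark 1.2.2, (ii), below] …".

`Proofs` companion (theorems only; no definitions, nothing restated) of abc-iut-L5-d4's
`PuncturedEllipticCoveringsCor12Assembly` (p432882) / `…Cor12Thm26` (p437972) / `…Cor12GeomTFG` over the merge adapter
`PuncturedEllipticCoveringsXbarCuspidalData` (the cusps of `X̲` as abc-iut-L4-t1 `CuspidalData` on the
`X̲`-extension `Π_X̲ ↠ aug(Π_X̲)`).  There the typed Cor. 1.2 took the PAIR-LEVEL binder `hLem45`: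
"every bicontinuous `Θ : Π_C ⥲ Π'_C` with `Θ(Π_X̲) = Π'_X̲` makes the decomposition groups of the cusps
of `X̲` and `X̲'` correspond up to `Π'_X̲`-conjugacy".  HERE this is DERIVED (with the extra clause
`Θ(Δ_C) = Δ'_C`, which the assembly has in hand) from layer L4's typed [AbsTopI] Lem. 4.5 (v)
BY NAME — abc-iut-L4-t4's `FundamentalExtension.CuspidalAlgorithm` ("a group-theoretic cuspidal
algorithm": a conjugation-stable set of closed subgroups assigned to every extension, transported along
isomorphisms preserving `Δ`) with the model-relative predicate `CuspidalAlgorithm.RecoversCusps`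
(FACT-LIST F-0206: "the algorithm's output on `E` is exactly the set of decomposition groups of cusps"),
instantiated at the two `X̲`-extensions with their cusps (`CuspGalois.cuspidalDataXbar`):

* `exists_continuousMulEquiv_extXbar` — a bicontinuous `Θ` with `Θ(Π_X̲) = Π'_X̲` restricts to an
  isomorphism of topological groups `α : Π_X̲ ⥲ Π'_X̲` of the `X̲`-extensions; `map_extXbar_geom_eq_of` —
  `α(Δ_X̲) = Δ'_X̲` when moreover `Θ(Δ_C) = Δ'_C`;
* `cusps_correspond_of_recoversCusps` — **`hLem45` derived**: functoriality (`CuspidalAlgorithm.transport`)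
  carries the output at `X̲` onto the output at `X̲'`, and `RecoversCusps` at both ends identifies the
  outputs with the classes of the `D_x`; pushed back into `Π_C` this is the cusp correspondence up to
  `Π'_X̲`-conjugacy, in both directions;
* `ofXarrow_of_geomIsMaxTFG_of_recoversCusps`, `characteristicNatureOfCoverings_of_geomIsMaxTFG_of_recoversCusps`
  (universe-polymorphic; `Δ`-input `GeomIsMaxTFGNormalIn ⊤` ×2, F-0005) and, at the `K`-level datum of
  two initial Θ-data over number fields (universe `0`),
  `InitialThetaData.pe_characteristicNatureOfCoverings_of_recoversCusps` — the typed Cor. 1.2 with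
  binders: `ArrowCoveringClaims` ×2, `CuspGalois` ×2 (data), the ramification of `ε⁰` ×2 (G-L5d4g6-1),
  number-field base data `NFBase` ×2 (data) and [AbsTopI] Prop. 2.2 `GeomTFG` ×2 (L4, F-0240) — the
  `Δ`-input, via the tree's proof of [AbsAnab] Thm. 1.1.2 (`…Cor12GeomTFG`) —, `htf`, `huniq'`
  ([AbsTopII] Cor. 3.3 (ii)/Rmk. 3.1.1 side conditions), `hext`/`hextC` (pure [AbsTopII] Cor. 3.3 (i)),
  ONE cuspidal algorithm `A` with `RecoversCusps` ×2 (L4, F-0206) — replacing `hLem45` — and `hLem45C`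
  (Lem. 4.5 for the ORBICURVE `C̲`, kept: its cusps are the cusps of `X̲` modulo `ι̲`, for which the
  frozen record has no carrier).

HONEST FRAMING: binders are assumption labels; typed ≠ discharged for the anabelian inputs, `GeomTFG`
and `RecoversCusps` (layer L4's nodes); nothing here takes a side on [IUTchIII] Cor. 3.12; no printed
statement is strengthened.
-/

namespace Literature.IUT.HodgeTheaters

namespace PuncturedEllipticData

open scoped Pointwise
open Literature.AnabelianGeometry.AbsoluteAnabelian
open Literature.AnabelianGeometry.AbsoluteAnabelian.FundamentalExtension (CuspidalAlgorithm)
open Literature.AnabelianGeometry.AbsoluteAnabelian.AbsTopII (semiEllipticDoubleCoverSubgroups)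

universe u

variable {D D' : PuncturedEllipticData.{u}}

/-! ### Restriction of a core isomorphism to the `X̲`-extensions -/

/-- A bicontinuous `Θ : Π_C ⥲ Π'_C` with `Θ(Π_X̲) = Π'_X̲` restricts to an isomorphism of topological
groups `α : Π_X̲ ⥲ Π'_X̲` between the `Π`'s of the two `X̲`-extensions. ([IUTchI] Cor 1.2 p.39)
[claim: Mochizuki2012, status: disputed] -/
theorem exists_continuousMulEquiv_extXbar (Θ : D.PiC ≃* D'.PiC) (hc : Continuous Θ)
    (hc' : Continuous Θ.symm) (hΘX : D.PiXbar.map Θ.toMonoidHom = D'.PiXbar) :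
    ∃ α : D.extXbar.arith ≃ₜ* D'.extXbar.arith, ∀ x : D.extXbar.arith, (α x).1 = Θ x.1 := by
  have hΘX' : D.PiXbar.map (Θ : D.PiC →* D'.PiC) = D'.PiXbar := by
    rw [← hΘX, MulEquiv.toMonoidHom_eq_coe]
  let Φ : D.PiXbar ≃* D'.PiXbar := (Θ.subgroupMap D.PiXbar).trans (MulEquiv.subgroupCongr hΘX')
  have hΦ : ∀ x : D.PiXbar, ((Φ x : D'.PiXbar) : D'.PiC) = Θ (x : D.PiC) := fun _ => rfl
  have hΦ' : ∀ y : D'.PiXbar, ((Φ.symm y : D.PiXbar) : D.PiC) = Θ.symm (y : D'.PiC) := by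
    intro y
    apply Θ.injective
    rw [MulEquiv.apply_symm_apply, ← hΦ, MulEquiv.apply_symm_apply]
  have hcΦ : Continuous fun x : D.PiXbar => ((Φ x : D'.PiXbar) : D'.PiC) := by
    rw [funext hΦ]
    exact hc.comp continuous_subtype_val
  have hcΦ' : Continuous fun y : D'.PiXbar => ((Φ.symm y : D.PiXbar) : D.PiC) := by
    rw [funext hΦ']
    exact hc'.comp continuous_subtype_val
  exact ⟨ContinuousMulEquiv.mk Φ (continuous_induced_rng.2 hcΦ) (continuous_induced_rng.2 hcΦ'), hΦ⟩

/-- If moreover `Θ(Δ_C) = Δ'_C`, the restriction `α` carries `Δ_X̲ = Δ_C ∩ Π_X̲` onto `Δ'_X̲`.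
([IUTchI] Cor 1.2 p.39) [claim: Mochizuki2012, status: disputed] -/
theorem map_extXbar_geom_eq_of (Θ : D.PiC ≃* D'.PiC) (α : D.extXbar.arith ≃ₜ* D'.extXbar.arith)
    (hα : ∀ x : D.extXbar.arith, (α x).1 = Θ x.1) (hΘX : D.PiXbar.map Θ.toMonoidHom = D'.PiXbar)
    (hΘΔ : D.DeltaC.map Θ.toMonoidHom = D'.DeltaC) :
    D.extXbar.geom.map α.toMulEquiv.toMonoidHom = D'.extXbar.geom := by
  ext y
  constructor
  · rintro ⟨x, hx, rfl⟩
    rw [SetLike.mem_coe, mem_extXbar_geom_iff] at hx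
    rw [mem_extXbar_geom_iff]
    change (α x).1 ∈ D'.DeltaC
    rw [hα, ← hΘΔ]
    exact ⟨x.1, hx, rfl⟩
  · intro hy
    rw [mem_extXbar_geom_iff, ← hΘΔ] at hy
    obtain ⟨z, hz, hzy⟩ := hy
    have hy2 : y.1 ∈ D'.PiXbar := y.2
    rw [← hΘX] at hy2
    obtain ⟨z', hz', hz'y⟩ := hy2
    have hzz' : z = z' := Θ.injective (hzy.trans hz'y.symm)
    subst hzz'
    refine ⟨⟨z, hz'⟩, (mem_extXbar_geom_iff _).2 hz, ?_⟩
    apply Subtype.ext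
    change (α ⟨z, hz'⟩).1 = y.1
    rw [hα]
    exact hzy

/-- Pushing `α(K)` into `Π'_C` is `Θ` applied to `K` pushed into `Π_C` (for `α` the restriction of `Θ`).
([IUTchI] Cor 1.2 p.39) [claim: Mochizuki2012, status: disputed] -/
theorem map_subtype_map_extXbar (Θ : D.PiC ≃* D'.PiC) (α : D.extXbar.arith ≃ₜ* D'.extXbar.arith)
    (hα : ∀ x : D.extXbar.arith, (α x).1 = Θ x.1) (K : Subgroup D.extXbar.arith) :
    (K.map α.toMulEquiv.toMonoidHom).map D'.PiXbar.subtype =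
      (K.map D.PiXbar.subtype).map Θ.toMonoidHom := by
  ext y
  constructor
  · rintro ⟨z, hz, rfl⟩
    obtain ⟨x, hx, rfl⟩ := hz
    exact ⟨x.1, ⟨x, hx, rfl⟩, (hα x).symm⟩
  · rintro ⟨z, hz, rfl⟩
    obtain ⟨x, hx, rfl⟩ := hz
    exact ⟨α x, ⟨x, hx, rfl⟩, hα x⟩

/-! ### `hLem45` from [AbsTopI] Lem. 4.5 (v) by name -/

/-- **"The decomposition groups of `ε⁰`, `ε′`, `ε″` in `Π_X̲` may be recovered as the decomposition groups
of cusps [cf. [AbsTopI], Lemma 4.5 …]"** (Cor. 1.2 proof p. 39) — the pair-level binder `hLem45` of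
`…Cor12Assembly` DERIVED from layer L4's typed Lem. 4.5 (v): GIVEN one group-theoretic cuspidal
algorithm `A` (abc-iut-L4-t4's `CuspidalAlgorithm`) that recovers the cusps of `X̲` and of `X̲'` on their
extensions (`RecoversCusps`, F-0206, at the two named instances), every bicontinuous `Θ : Π_C ⥲ Π'_C`
with `Θ(Π_X̲) = Π'_X̲` and `Θ(Δ_C) = Δ'_C` carries each `D_x` (`x` a cusp of `X̲`) to a
`Π'_X̲`-conjugate of some `D'_{x'}`, and each `D'_{x'}` is so obtained. ([IUTchI] Cor 1.2 p.39)
[claim: Mochizuki2012, status: disputed] -/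
theorem cusps_correspond_of_recoversCusps (C : D.CuspGalois) (C' : D'.CuspGalois)
    (A : CuspidalAlgorithm.{u}) (hA : A.RecoversCusps D.extXbar C.cuspidalDataXbar)
    (hA' : A.RecoversCusps D'.extXbar C'.cuspidalDataXbar) (Θ : D.PiC ≃* D'.PiC) (hc : Continuous Θ)
    (hc' : Continuous Θ.symm) (hΘX : D.PiXbar.map Θ.toMonoidHom = D'.PiXbar)
    (hΘΔ : D.DeltaC.map Θ.toMonoidHom = D'.DeltaC) :
    (∀ x : D.Cusp, ∃ x' : D'.Cusp, ∃ t' ∈ D'.PiXbar,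
        (D.decomp x).map Θ.toMonoidHom = MulAut.conj t' • D'.decomp x') ∧
      (∀ x' : D'.Cusp, ∃ x : D.Cusp, ∃ t' ∈ D'.PiXbar,
        (D.decomp x).map Θ.toMonoidHom = MulAut.conj t' • D'.decomp x') := by
  obtain ⟨α, hα⟩ := exists_continuousMulEquiv_extXbar Θ hc hc' hΘX
  have htr := A.transport D.extXbar D'.extXbar α (map_extXbar_geom_eq_of Θ α hα hΘX hΘΔ)
  unfold CuspidalAlgorithm.RecoversCusps at hA hA'
  constructor
  · intro x
    have hx : C.cuspidalDataXbar.Dcusp x ∈ A.out D.extXbar := by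
      rw [hA]
      exact Set.mem_iUnion.2 ⟨x, C.cuspidalDataXbar.Dcusp_mem_decompositionClass x⟩
    have hx' : (C.cuspidalDataXbar.Dcusp x).map α.toMulEquiv.toMonoidHom ∈ A.out D'.extXbar := by
      rw [htr]
      exact ⟨_, hx, rfl⟩
    rw [hA'] at hx'
    obtain ⟨x', hx'⟩ := Set.mem_iUnion.1 hx'
    obtain ⟨g', hg'⟩ := hx'
    refine ⟨x', g'.1, g'.2, ?_⟩
    calc (D.decomp x).map Θ.toMonoidHom
        = ((C.cuspidalDataXbar.Dcusp x).map D.PiXbar.subtype).map Θ.toMonoidHom := by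
          rw [C.map_subtype_cuspidalDataXbar_Dcusp]
      _ = ((C.cuspidalDataXbar.Dcusp x).map α.toMulEquiv.toMonoidHom).map D'.PiXbar.subtype :=
          (map_subtype_map_extXbar Θ α hα _).symm
      _ = (MulAut.conj g' • C'.cuspidalDataXbar.Dcusp x').map D'.PiXbar.subtype := by rw [hg']
      _ = MulAut.conj g'.1 • D'.decomp x' := C'.map_subtype_conj_smul_cuspidalDataXbar_Dcusp g' x'
  · intro x'
    have hx' : C'.cuspidalDataXbar.Dcusp x' ∈ A.out D'.extXbar := by
      rw [hA']
      exact Set.mem_iUnion.2 ⟨x', C'.cuspidalDataXbar.Dcusp_mem_decompositionClass x'⟩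
    rw [htr] at hx'
    obtain ⟨K, hK, hKeq⟩ := hx'
    rw [hA] at hK
    obtain ⟨x, hK⟩ := Set.mem_iUnion.1 hK
    obtain ⟨g, rfl⟩ := hK
    have hKeq' : (MulAut.conj g • C.cuspidalDataXbar.Dcusp x).map α.toMulEquiv.toMonoidHom =
        C'.cuspidalDataXbar.Dcusp x' := hKeq
    have e : (MulAut.conj g.1 • D.decomp x).map Θ.toMonoidHom = D'.decomp x' :=
      calc (MulAut.conj g.1 • D.decomp x).map Θ.toMonoidHom
          = ((MulAut.conj g • C.cuspidalDataXbar.Dcusp x).map D.PiXbar.subtype).map Θ.toMonoidHom := by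
            rw [C.map_subtype_conj_smul_cuspidalDataXbar_Dcusp]
        _ = ((MulAut.conj g • C.cuspidalDataXbar.Dcusp x).map α.toMulEquiv.toMonoidHom).map
              D'.PiXbar.subtype := (map_subtype_map_extXbar Θ α hα _).symm
        _ = (C'.cuspidalDataXbar.Dcusp x').map D'.PiXbar.subtype := by rw [hKeq']
        _ = D'.decomp x' := C'.map_subtype_cuspidalDataXbar_Dcusp x'
    rw [map_conj_smul] at e
    have hΘg : Θ.toMonoidHom g.1 ∈ D'.PiXbar := by
      rw [← hΘX]
      exact ⟨g.1, g.2, rfl⟩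
    refine ⟨x, (Θ.toMonoidHom g.1)⁻¹, D'.PiXbar.inv_mem hΘg, ?_⟩
    rw [← e, ← mul_smul, ← map_mul, inv_mul_cancel, map_one, one_smul]

/-! ### Corollary 1.2 assembled with `hLem45` from Lem. 4.5 (v) -/

/-- **The `Π_{X̲→}`-clause of Corollary 1.2**, assembled as in `ofXarrow_of_anabelian` (p432882) but with
the cusp correspondence supplied by `cusps_correspond_of_recoversCusps` ([AbsTopI] Lem. 4.5 (v) BY
NAME) and the extension `Θ` by `core_extension_of_geomIsMaxTFGNormalIn` ([AbsAnab] Lem. 1.1.4 (i) /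
[AbsTopI] Thm. 2.6 (vi) conclusion `GeomIsMaxTFGNormalIn ⊤` BY NAME, [AbsTopII] Cor. 3.3 (i)/(ii)).
([IUTchI] Cor 1.2 p.39) [claim: Mochizuki2012, status: disputed] -/
theorem ofXarrow_of_geomIsMaxTFG_of_recoversCusps (h : D.ArrowCoveringClaims)
    (h' : D'.ArrowCoveringClaims) (C : D.CuspGalois) (C' : D'.CuspGalois)
    (hX : D.PiXbar.relIndex D.PiX = D.l) (hX' : D'.PiXbar.relIndex D'.PiX = D'.l)
    (h0 : ¬ D.inertia D.ε0 ≤ D.piXarrow) (h0' : ¬ D'.inertia D'.ε0 ≤ D'.piXarrow)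
    (h114 : D.E.GeomIsMaxTFGNormalIn ⊤) (h114' : D'.E.GeomIsMaxTFGNormalIn ⊤)
    (htf : IsMulTorsionFree ↥(D.PiX ⊓ D.DeltaC))
    (huniq' : ∀ J ∈ semiEllipticDoubleCoverSubgroups D'.E, J ⊓ D'.DeltaC = D'.PiX ⊓ D'.DeltaC)
    (hext : ∀ φ : D.piXarrow ≃* D'.piXarrow, Continuous φ → Continuous φ.symm →
      ∃ Θ : D.PiC ≃ₜ* D'.PiC, ∀ x : D.piXarrow, Θ (x : D.PiC) = (φ x : D'.PiC))
    (A : CuspidalAlgorithm.{u}) (hA : A.RecoversCusps D.extXbar C.cuspidalDataXbar)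
    (hA' : A.RecoversCusps D'.extXbar C'.cuspidalDataXbar) :
    ∀ φ : D.piXarrow ≃* D'.piXarrow, Continuous φ → Continuous φ.symm →
      ∃ Φ : D.PiCbar ≃* D'.PiCbar, Continuous Φ ∧
        (∀ (x : D.PiC) (hx : x ∈ D.piXarrow) (hx' : x ∈ D.PiCbar),
          (Φ ⟨x, hx'⟩ : D'.PiC) = (φ ⟨x, hx⟩ : D'.PiC)) ∧
        Subgroup.map Φ.toMonoidHom '' D.cuspClassX = D'.cuspClassX ∧
        Subgroup.map Φ.toMonoidHom '' D.cuspClassC = D'.cuspClassC := by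
  intro φ hφ hφ'
  obtain ⟨Θ, hc, hc', hΘext, hΘX, hΘΔ⟩ :=
    core_extension_of_geomIsMaxTFGNormalIn h114 h114' htf huniq' hext φ hφ hφ'
  have hΘ : D.piXarrow.map Θ.toMonoidHom = D'.piXarrow := map_eq_of_extends φ Θ hΘext
  have hΘXbar : D.PiXbar.map Θ.toMonoidHom = D'.PiXbar :=
    h.map_piXbar_eq_of_map_deltaX h' C C' hX hX' Θ hc hc' hΘ hΘX hΘΔ
  obtain ⟨hcusp, hcusp'⟩ := cusps_correspond_of_recoversCusps C C' A hA hA' Θ hc hc' hΘXbar hΘΔ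
  have hΘCbar : D.PiCbar.map Θ.toMonoidHom = D'.PiCbar :=
    h.map_piCbar_eq_of_cusps h' C C' hX hX' h0 h0' Θ hc hc' hΘ hΘX hΘΔ hcusp'
  obtain ⟨Φ, hΦc, hΦ⟩ := exists_continuous_restrict_piCbar Θ hc hΘCbar
  refine ⟨Φ, hΦc, fun x hx hx' => ?_,
    image_map_subtype_transport Θ Φ hΦ _ _
      (image_cuspClassX_eq h h' C C' Θ hΘ hΘΔ hΘXbar hΘCbar h0 h0' hcusp hcusp'),
    image_map_subtype_transport Θ Φ hΦ _ _
      (image_cuspClassC_eq h h' C C' Θ hΘ hΘΔ hΘXbar hΘCbar h0 h0' hcusp)⟩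
  rw [hΦ ⟨x, hx'⟩]
  exact hΘext ⟨x, hx⟩

/-- **Corollary 1.2 (Characteristic Nature of Coverings) with [AbsAnab] Lem. 1.1.4 (i) / [AbsTopI]
Thm. 2.6 (vi)'s conclusion, [AbsTopI] Lem. 4.5 (v) and the [AbsTopII] Cor. 3.3 (ii) transport supplied
BY NAME from layer L4.**  Binders (assumption labels, never asserted): `ArrowCoveringClaims` ×2,
`CuspGalois` ×2 (data), the law `[Π_X : Π_X̲] = l` ×2, the ramification of `ε⁰` ×2 (G-L5d4g6-1),
`GeomIsMaxTFGNormalIn ⊤` ×2 (F-0005), `htf`, `huniq'`, `hext`, `hextC` (pure [AbsTopII] Cor. 3.3 (i)),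
ONE cuspidal algorithm `A` with `RecoversCusps` at the two `X̲`-extensions (F-0206), and the [AbsTopI]
Lem. 4.5 shape `hLem45C` for the orbicurve `C̲` (resp'd clause). ([IUTchI] Cor 1.2 p.39)
[claim: Mochizuki2012, status: disputed] -/
theorem characteristicNatureOfCoverings_of_geomIsMaxTFG_of_recoversCusps (h : D.ArrowCoveringClaims)
    (h' : D'.ArrowCoveringClaims) (C : D.CuspGalois) (C' : D'.CuspGalois)
    (hX : D.PiXbar.relIndex D.PiX = D.l) (hX' : D'.PiXbar.relIndex D'.PiX = D'.l)
    (h0 : ¬ D.inertia D.ε0 ≤ D.piXarrow) (h0' : ¬ D'.inertia D'.ε0 ≤ D'.piXarrow)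
    (h114 : D.E.GeomIsMaxTFGNormalIn ⊤) (h114' : D'.E.GeomIsMaxTFGNormalIn ⊤)
    (htf : IsMulTorsionFree ↥(D.PiX ⊓ D.DeltaC))
    (huniq' : ∀ J ∈ semiEllipticDoubleCoverSubgroups D'.E, J ⊓ D'.DeltaC = D'.PiX ⊓ D'.DeltaC)
    (hext : ∀ φ : D.piXarrow ≃* D'.piXarrow, Continuous φ → Continuous φ.symm →
      ∃ Θ : D.PiC ≃ₜ* D'.PiC, ∀ x : D.piXarrow, Θ (x : D.PiC) = (φ x : D'.PiC))
    (hextC : ∀ ψ : D.piCarrow ≃* D'.piCarrow, Continuous ψ → Continuous ψ.symm →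
      ∃ Θ : D.PiC ≃ₜ* D'.PiC, ∀ x : D.piCarrow, Θ (x : D.PiC) = (ψ x : D'.PiC))
    (A : CuspidalAlgorithm.{u}) (hA : A.RecoversCusps D.extXbar C.cuspidalDataXbar)
    (hA' : A.RecoversCusps D'.extXbar C'.cuspidalDataXbar)
    (hLem45C : ∀ Θ : D.PiC ≃* D'.PiC, Continuous Θ → Continuous Θ.symm →
      D.PiCbar.map Θ.toMonoidHom = D'.PiCbar →
        (∀ x : D.Cusp, x ≠ D.ε0 → ∃ x' : D'.Cusp, x' ≠ D'.ε0 ∧ ∃ t' ∈ D'.PiCbar,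
          (D.decomp x).map Θ.toMonoidHom = MulAut.conj t' • D'.decomp x') ∧
        (∀ x' : D'.Cusp, x' ≠ D'.ε0 → ∃ x : D.Cusp, x ≠ D.ε0 ∧ ∃ t' ∈ D'.PiCbar,
          (D.decomp x).map Θ.toMonoidHom = MulAut.conj t' • D'.decomp x')) :
    D.CharacteristicNatureOfCoverings D' :=
  characteristicNatureOfCoverings_of_core_extensions h h'
    (ofXarrow_of_geomIsMaxTFG_of_recoversCusps h h' C C' hX hX' h0 h0' h114 h114' htf huniq' hext A
      hA hA')
    (ofCarrow_of_anabelian h h' C C' hX hX'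
      (core_extension_of_geomIsMaxTFGNormalIn h114 h114' htf huniq' hextC) hLem45C)

end PuncturedEllipticData

/-! ### At the `K`-level §1 datum of two initial Θ-data over number fields (universe `0`) -/

namespace InitialThetaData

open scoped Pointwise
open Literature.AnabelianGeometry.AbsoluteAnabelian
open Literature.AnabelianGeometry.AbsoluteAnabelian.FundamentalExtension (CuspidalAlgorithm)
open Literature.AnabelianGeometry.AbsoluteAnabelian.AbsTopII (semiEllipticDoubleCoverSubgroups)

universe u v u' v'

variable {F : Type u} {K : Type v} {Fbar : Type} [Field F] [NumberField F] [Field K] [NumberField K]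
  [Algebra F K] [Field Fbar] [Algebra F Fbar] [Algebra K Fbar]
  {E : WeierstrassCurve F} [E.IsElliptic] {l : ℕ} {Pb : BadPlacePredicates K}
  (D : InitialThetaData F K Fbar E l Pb)
  {F' : Type u'} {K' : Type v'} [Field F'] [NumberField F'] [Field K'] [NumberField K'] [Algebra F' K']
  {Fbar' : Type} [Field Fbar'] [Algebra F' Fbar'] [Algebra K' Fbar']
  {E' : WeierstrassCurve F'} [E'.IsElliptic] {l' : ℕ} {Pb' : BadPlacePredicates K'}
  (D' : InitialThetaData F' K' Fbar' E' l' Pb')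

/-- **[IUTchI] Cor. 1.2 between the `K`-level data of two initial Θ-data over number fields, with
[AbsTopI] Prop. 2.2, Lem. 4.5 (v) and [AbsTopII] Cor. 3.3 (ii) supplied from layer L4 BY NAME**
(algebraic closures in universe `0`).  Compared with `pe_characteristicNatureOfCoverings_of_geomTFG`
(`…Cor12GeomTFG`): the pair-level binder `hLem45` is replaced by ONE cuspidal algorithm `A` recovering
the cusps of `X̲_K` and of `X̲_{K'}` (`RecoversCusps` at the two `X̲`-extensions, F-0206); the
`Δ`-input is number-field base data `NFBase` ×2 (data) + `GeomTFG` ×2 ([AbsTopI] Prop. 2.2); the law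
`[Π_X : Π_X̲] = l` is DISCHARGED by Def. 3.1 (d). ([IUTchI] Cor 1.2 p.39) [claim: Mochizuki2012,
status: disputed] -/
theorem pe_characteristicNatureOfCoverings_of_recoversCusps (h : D.geom.pe.ArrowCoveringClaims)
    (h' : D'.geom.pe.ArrowCoveringClaims) (C : D.geom.pe.CuspGalois) (C' : D'.geom.pe.CuspGalois)
    (h0 : ¬ D.geom.pe.inertia D.geom.pe.ε0 ≤ D.geom.pe.piXarrow)
    (h0' : ¬ D'.geom.pe.inertia D'.geom.pe.ε0 ≤ D'.geom.pe.piXarrow)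
    (B : D.geom.pe.E.NFBase) (B' : D'.geom.pe.E.NFBase) (hΔ : D.geom.pe.E.GeomTFG)
    (hΔ' : D'.geom.pe.E.GeomTFG) (htf : IsMulTorsionFree ↥(D.geom.pe.PiX ⊓ D.geom.pe.DeltaC))
    (huniq' : ∀ J ∈ semiEllipticDoubleCoverSubgroups D'.geom.pe.E,
      J ⊓ D'.geom.pe.DeltaC = D'.geom.pe.PiX ⊓ D'.geom.pe.DeltaC)
    (hext : ∀ φ : D.geom.pe.piXarrow ≃* D'.geom.pe.piXarrow, Continuous φ → Continuous φ.symm →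
      ∃ Θ : D.geom.pe.PiC ≃ₜ* D'.geom.pe.PiC,
        ∀ x : D.geom.pe.piXarrow, Θ (x : D.geom.pe.PiC) = (φ x : D'.geom.pe.PiC))
    (hextC : ∀ ψ : D.geom.pe.piCarrow ≃* D'.geom.pe.piCarrow, Continuous ψ → Continuous ψ.symm →
      ∃ Θ : D.geom.pe.PiC ≃ₜ* D'.geom.pe.PiC,
        ∀ x : D.geom.pe.piCarrow, Θ (x : D.geom.pe.PiC) = (ψ x : D'.geom.pe.PiC))
    (A : CuspidalAlgorithm.{0}) (hA : A.RecoversCusps D.geom.pe.extXbar C.cuspidalDataXbar)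
    (hA' : A.RecoversCusps D'.geom.pe.extXbar C'.cuspidalDataXbar)
    (hLem45C : ∀ Θ : D.geom.pe.PiC ≃* D'.geom.pe.PiC, Continuous Θ → Continuous Θ.symm →
      D.geom.pe.PiCbar.map Θ.toMonoidHom = D'.geom.pe.PiCbar →
        (∀ x : D.geom.pe.Cusp, x ≠ D.geom.pe.ε0 → ∃ x' : D'.geom.pe.Cusp, x' ≠ D'.geom.pe.ε0 ∧
          ∃ t' ∈ D'.geom.pe.PiCbar,
            (D.geom.pe.decomp x).map Θ.toMonoidHom = MulAut.conj t' • D'.geom.pe.decomp x') ∧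
        (∀ x' : D'.geom.pe.Cusp, x' ≠ D'.geom.pe.ε0 → ∃ x : D.geom.pe.Cusp, x ≠ D.geom.pe.ε0 ∧
          ∃ t' ∈ D'.geom.pe.PiCbar,
            (D.geom.pe.decomp x).map Θ.toMonoidHom = MulAut.conj t' • D'.geom.pe.decomp x')) :
    D.geom.pe.CharacteristicNatureOfCoverings D'.geom.pe :=
  PuncturedEllipticData.characteristicNatureOfCoverings_of_geomIsMaxTFG_of_recoversCusps h h' C C'
    D.pe_relIndex_piXbar_piX D'.pe_relIndex_piXbar_piX h0 h0'
    (PuncturedEllipticData.geomIsMaxTFGNormalIn_of_geomTFG B hΔ)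
    (PuncturedEllipticData.geomIsMaxTFGNormalIn_of_geomTFG B' hΔ') htf huniq' hext hextC A hA hA'
    hLem45C

end InitialThetaData

end Literature.IUT.HodgeTheaters
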